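import Literature.AlgebraicGeometry.Resolution.HironakaGroupSchemeMultiplicity
import Literature.AlgebraicGeometry.Resolution.DiffStableTriangular
import Literature.AlgebraicGeometry.Resolution.RidgeHasseStabiliser
import HarnessLib

/-!
# Hironaka's `U(𝔭)` is generated by additive forms — discharge of the named fact `Hironaka1970_thm1_cor`
# (Hironaka 1970, Th. 1 Cor.; Mizutani 1973 p. 85; proof printed in Dietel 2015, Lemma (9.1.4))

Topic: `Literature/AlgebraicGeometry/Resolution`, sub-namespace `HironakaScheme` (the namespace of
`HironakaGroupSchemeMultiplicity.lean`, whose named fact `Hironaka1970_thm1_cor` — fact F-52 of the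
cell res-hironaka, «`U(𝔭)` is generated as a `k`-algebra by purely inseparable forms
`a_0 X_0^{p^e} + ⋯ + a_n X_n^{p^e}`» — is DISCHARGED here: `Hironaka1970_thm1_cor_holds`).

For a field `k` of characteristic `p > 0`, `S = k[X_0, …, X_n]` and a prime `𝔭 ⊆ S`, Hironaka's graded algebra
`U(𝔭) = Σ_d U_d`, `U_d = {f ∈ S_d : f ∈ 𝔭^d S_𝔭}` (`multAlgebra k 𝔭`, generated by `multGens k 𝔭`, the forms of
degree `d` in the `d`-th symbolic power `symbPow k 𝔭 d`).

## Proof (the printed route of Dietel 2015, Lemma (9.1.4) p. 108, criterion (ii)/(iii) of Prop. (3.4.3) p. 43)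

1. `hasseDeriv_mem_symbPow` — **the Hasse–Schmidt derivatives lower symbolic powers of a prime by their order**:
   `D^{(β)}(𝔭^{(m)}) ⊆ 𝔭^{(m − |β|)}` for EVERY prime `𝔭` of `k[X_σ]` over ANY commutative… here: any field `k`
   (no perfectness, no separability of `k(𝔭)/k`): from `s f ∈ 𝔭^m`, `s ∉ 𝔭`, the higher Leibniz rule
   `D^{(β)}(s f) = s·D^{(β)} f + Σ_{γ+δ=β, γ≠0} D^{(γ)} s · D^{(δ)} f` (`hasseDeriv_mul`), `D^{(β)}(𝔭^m) ⊆ 𝔭^{m−|β|}`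
   (`IsDiffOpLE.apply_mem_pow_sub` with `isDiffOpLE_hasseDeriv`) and induction on `|β|` give
   `s · D^{(β)} f ∈ 𝔭^{(m−|β|)}`, whence `D^{(β)} f ∈ 𝔭^{(m−|β|)}` (`𝔭` prime). This replaces Dietel's differential
   characterisation (9.1.2)/(9.1.4.A) `(U_x)_d = {f ∈ S_d | Diff^{≤ d−1}(f) ⊆ 𝔭}`, which over an imperfect `k` is
   only available for residually separable points; the Leibniz route needs nothing.
2. Hence `U(𝔭)` is a graded subalgebra stable under all `D^{(β)}` (`isGradedSubalgebra_multAlgebra`,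
   `isDiffStable_multAlgebra`; Dietel (3.4.3) (ii)⇒(iii): a derivative of order `≥ d` of a form of degree `d` is a
   constant) — via `IsGradedSubalgebra.adjoin` / `IsDiffStable.adjoin` of `DiffStableAdjoin.lean` and
   `isHomogeneous_hasseDeriv_of_isHomogeneous`.
3. The tree's structure theorem for graded Hasse–Schmidt-stable subalgebras over an ARBITRARY field,
   `exists_eq_adjoin_triangular_of_isDiffStable_fin` (`DiffStableTriangular.lean`; Hironaka 1970, Giraud 1975 §1.6 (3);
   = Dietel Prop. (3.4.3) (iii)⇒(v)), writes `U(𝔭) = k[σ_1, …, σ_r]` with `σ_j = Σ_l c_{jl} X_l^{p^{e_j}}`, i.e.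
   `σ_j = addForm k p e_j c_j` — so `U(𝔭)` is the `k`-algebra generated by the additive forms it contains.

The statement proved is `Hironaka1970_thm1_cor p` verbatim (all fields `k` of characteristic `p`, all `n`, every
`𝔭` with `IsPoint k 𝔭`; only primality of `𝔭` is used). Written for the cell res-hironaka (HIRONAKA-L, librarian seat
res-D-lib-1; consumers: `KangarooAtlas/MizutaniVectorGroup.lean`, `…/MizutaniHironakaDimension.lean`, W4.2 T7
`…Corridor3Directrix214Sharp`). Nothing here is a statement of H. Hironaka's 2017 manuscript. AI-written; AI review is
weaker than expert review.

## References

* H. Hironaka, *Additive groups associated with points of a projective space*, Ann. of Math. 92 (1970) 327–334,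
  Th. 1 and Cor. [Hironaka1970AdditiveGroups]
* H. Mizutani, *Hironaka's additive group schemes*, Nagoya Math. J. 52 (1973), p. 85 L26–28.
  [Mizutani1973HironakaGroupSchemes]
* B. Dietel, *A refinement of Hironaka's additive group schemes for an extended invariant*, Dissertation Regensburg
  (2015): Lemma (9.1.4) p. 108, Prop. (3.4.3) p. 43, Lemma (3.4.2) p. 42. [Dietel2015]
* A. Grothendieck, EGA IV₄, Thm. 16.11.2 (the operators `D_p`). [EGAIV4]
-/

noncomputable section

open MvPolynomial

namespace Literature.AlgebraicGeometry.Resolution.HironakaScheme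

universe u v

/-! ## 1. Calculus of the symbolic powers `𝔭^{(d)} = {f | ∃ s ∉ 𝔭, s f ∈ 𝔭^d}` -/

section SymbPow

variable {k : Type u} [Field k] {σ : Type v} {𝔭 : Ideal (MvPolynomial σ k)}

/-- `𝔭^{(e)} ⊆ 𝔭^{(d)}` for `d ≤ e`. [cite: Dietel2015, Lemma (9.1.4) p. 108] -/
theorem symbPow_mono {d e : ℕ} (h : d ≤ e) : symbPow k 𝔭 e ⊆ symbPow k 𝔭 d := by
  rintro f ⟨s, hs, hsf⟩
  exact ⟨s, hs, Ideal.pow_le_pow_right h hsf⟩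

/-- `𝔭^d ⊆ 𝔭^{(d)}` (witness `s = 1`, for `𝔭 ≠ S`). [cite: Dietel2015, Lemma (9.1.4) p. 108] -/
theorem mem_symbPow_of_mem_pow (h𝔭 : 𝔭 ≠ ⊤) {d : ℕ} {f : MvPolynomial σ k} (hf : f ∈ 𝔭 ^ d) :
    f ∈ symbPow k 𝔭 d :=
  ⟨1, fun h => h𝔭 ((Ideal.eq_top_iff_one 𝔭).mpr h), by rwa [one_mul]⟩

/-- `𝔭^{(d)}` is stable under multiplication by ring elements. [cite: Dietel2015, Lemma (9.1.4) p. 108] -/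
theorem mul_mem_symbPow_left (t : MvPolynomial σ k) {d : ℕ} {f : MvPolynomial σ k}
    (hf : f ∈ symbPow k 𝔭 d) : t * f ∈ symbPow k 𝔭 d := by
  obtain ⟨s, hs, hsf⟩ := hf
  refine ⟨s, hs, ?_⟩
  rw [mul_left_comm]
  exact Ideal.mul_mem_left _ t hsf

/-- `𝔭^{(d)}` is closed under sums (for `𝔭` prime: multiply the witnesses). [cite: Dietel2015, Lemma (9.1.4) p. 108] -/
theorem add_mem_symbPow [h𝔭 : 𝔭.IsPrime] {d : ℕ} {f g : MvPolynomial σ k} (hf : f ∈ symbPow k 𝔭 d)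
    (hg : g ∈ symbPow k 𝔭 d) : f + g ∈ symbPow k 𝔭 d := by
  obtain ⟨s, hs, hsf⟩ := hf
  obtain ⟨t, ht, htg⟩ := hg
  refine ⟨s * t, fun h => (h𝔭.mem_or_mem h).elim hs ht, ?_⟩
  rw [mul_add, show s * t * f = t * (s * f) by ring, show s * t * g = s * (t * g) by ring]
  exact Ideal.add_mem _ (Ideal.mul_mem_left _ t hsf) (Ideal.mul_mem_left _ s htg)

/-- `0 ∈ 𝔭^{(d)}` (for `𝔭 ≠ S`). [cite: Dietel2015, Lemma (9.1.4) p. 108] -/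
theorem zero_mem_symbPow (h𝔭 : 𝔭 ≠ ⊤) (d : ℕ) : (0 : MvPolynomial σ k) ∈ symbPow k 𝔭 d :=
  mem_symbPow_of_mem_pow h𝔭 (Ideal.zero_mem _)

/-- Finite sums of elements of `𝔭^{(d)}` lie in `𝔭^{(d)}` (`𝔭` prime). [cite: Dietel2015, Lemma (9.1.4) p. 108] -/
theorem sum_mem_symbPow [h𝔭 : 𝔭.IsPrime] {d : ℕ} {ι : Type*} (s : Finset ι) (g : ι → MvPolynomial σ k)
    (h : ∀ i ∈ s, g i ∈ symbPow k 𝔭 d) : ∑ i ∈ s, g i ∈ symbPow k 𝔭 d := by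
  classical
  induction s using Finset.induction_on with
  | empty => rw [Finset.sum_empty]; exact zero_mem_symbPow h𝔭.ne_top d
  | insert a s ha ih =>
    rw [Finset.sum_insert ha]
    exact add_mem_symbPow (h a (Finset.mem_insert_self a s))
      (ih fun i hi => h i (Finset.mem_insert_of_mem hi))

/-- Elements of `𝔭^{(d)}` may be cancelled by factors off `𝔭`: `s ∉ 𝔭`, `s f ∈ 𝔭^{(d)} ⇒ f ∈ 𝔭^{(d)}`
(`𝔭` prime). [cite: Dietel2015, Lemma (9.1.4) p. 108] -/
theorem mem_symbPow_of_mul_mem [h𝔭 : 𝔭.IsPrime] {d : ℕ} {s f : MvPolynomial σ k} (hs : s ∉ 𝔭)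
    (h : s * f ∈ symbPow k 𝔭 d) : f ∈ symbPow k 𝔭 d := by
  obtain ⟨t, ht, htsf⟩ := h
  exact ⟨t * s, fun h' => (h𝔭.mem_or_mem h').elim ht hs, by rwa [mul_assoc]⟩

/-- `a + b ∈ 𝔭^{(d)}` and `b ∈ 𝔭^{(d)}` give `a ∈ 𝔭^{(d)}` (`𝔭` prime). [cite: Dietel2015, Lemma (9.1.4) p. 108] -/
theorem mem_symbPow_of_add_mem [𝔭.IsPrime] {d : ℕ} {a b : MvPolynomial σ k}
    (hab : a + b ∈ symbPow k 𝔭 d) (hb : b ∈ symbPow k 𝔭 d) : a ∈ symbPow k 𝔭 d := by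
  have h := add_mem_symbPow hab (mul_mem_symbPow_left (-1) hb)
  rwa [neg_one_mul, add_neg_cancel_right] at h

variable [DecidableEq σ]

/-- **The Hasse–Schmidt derivatives lower the symbolic powers of a prime by their order**:
`f ∈ 𝔭^{(m)} ⇒ D^{(β)} f ∈ 𝔭^{(m − |β|)}` for every prime `𝔭` of `k[X_σ]`, every field `k` (induction on `|β|`
through the higher Leibniz rule applied to `s·f ∈ 𝔭^m`; the bound `|β| ≤ N` is the induction parameter).
This is the operator half of Dietel's (9.1.4.A)/(3.4.3) (ii) for `U_x`, proved without the differential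
characterisation of `ν_x`. [cite: Dietel2015, Lemma (9.1.4) p. 108 and Cor. (9.1.2) p. 107] -/
theorem hasseDeriv_mem_symbPow_of_degree_le [h𝔭 : 𝔭.IsPrime] (m : ℕ) :
    ∀ (N : ℕ) (β : σ →₀ ℕ), β.degree ≤ N → ∀ {f : MvPolynomial σ k}, f ∈ symbPow k 𝔭 m →
      hasseDeriv k β f ∈ symbPow k 𝔭 (m - β.degree)
  | 0, β, hβ, f, hf => by
    have hβ0 : β = 0 := (Finsupp.degree_eq_zero_iff β).1 (Nat.le_zero.1 hβ)
    subst hβ0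
    simpa using hf
  | N + 1, β, hβ, f, hf => by
    obtain ⟨s, hs, hsf⟩ := hf
    -- `D^{(β)}(s f) ∈ 𝔭^{m − |β|}`
    have h1 : hasseDeriv k β (s * f) ∈ 𝔭 ^ (m - β.degree) :=
      (isDiffOpLE_hasseDeriv k β.degree β le_rfl).apply_mem_pow_sub 𝔭 m hsf
    have h0 : ((0 : σ →₀ ℕ), β) ∈ Finset.antidiagonal β := by simp
    rw [hasseDeriv_mul, ← Finset.add_sum_erase _ _ h0, hasseDeriv_zero_apply] at h1
    -- the punctured sum lies in `𝔭^{(m − |β|)}` by induction (`|δ| < |β|` there)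
    have h2 : ∑ q ∈ (Finset.antidiagonal β).erase (0, β),
        hasseDeriv k q.1 s * hasseDeriv k q.2 f ∈ symbPow k 𝔭 (m - β.degree) := by
      refine sum_mem_symbPow _ _ fun q hq => ?_
      have hlt := degree_snd_lt_of_mem_erase_antidiagonal hq
      have ih := hasseDeriv_mem_symbPow_of_degree_le m N q.2 (by omega) (f := f) ⟨s, hs, hsf⟩
      exact mul_mem_symbPow_left _ (symbPow_mono (by omega) ih)
    have h3 : s * hasseDeriv k β f ∈ symbPow k 𝔭 (m - β.degree) :=
      mem_symbPow_of_add_mem (mem_symbPow_of_mem_pow h𝔭.ne_top h1) h2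
    exact mem_symbPow_of_mul_mem hs h3

/-- `D^{(β)}(𝔭^{(m)}) ⊆ 𝔭^{(m − |β|)}` for every prime `𝔭 ⊆ k[X_σ]` and every `β`.
[cite: Dietel2015, Lemma (9.1.4) p. 108] -/
theorem hasseDeriv_mem_symbPow [𝔭.IsPrime] {m : ℕ} {f : MvPolynomial σ k} (hf : f ∈ symbPow k 𝔭 m)
    (β : σ →₀ ℕ) : hasseDeriv k β f ∈ symbPow k 𝔭 (m - β.degree) :=
  hasseDeriv_mem_symbPow_of_degree_le m β.degree β le_rfl hf

/-- The homogeneous generators `U_d(𝔭)` of `U(𝔭)` are permuted by the Hasse–Schmidt derivatives: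
`f ∈ U_d ⇒ D^{(β)} f ∈ U_{d − |β|}` (Dietel (3.4.3) (ii) for `H = U_x`). [cite: Dietel2015, Lemma (9.1.4) p. 108 (proof, «D_M(f) ∈ (U_x)_{d−|M|}»)] -/
theorem hasseDeriv_mem_multGens [𝔭.IsPrime] {φ : MvPolynomial σ k} (hφ : φ ∈ multGens k 𝔭)
    (β : σ →₀ ℕ) : hasseDeriv k β φ ∈ multGens k 𝔭 := by
  obtain ⟨d, hφd, hφ⟩ := hφ
  exact ⟨d - β.degree, isHomogeneous_hasseDeriv_of_isHomogeneous hφd β, hasseDeriv_mem_symbPow hφ β⟩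

end SymbPow

/-! ## 2. `U(𝔭)` is graded and Hasse–Schmidt stable -/

section Stable

variable {k : Type u} [Field k] {σ : Type v}

/-- `U(𝔭)` is a GRADED subalgebra of `k[X_σ]` (generated by forms). [cite: Dietel2015, Lemma (9.1.4) p. 108 («U_x is a graded k-subalgebra»)] -/
theorem isGradedSubalgebra_multAlgebra (𝔭 : Ideal (MvPolynomial σ k)) :
    IsGradedSubalgebra (multAlgebra k 𝔭) :=
  IsGradedSubalgebra.adjoin fun _ ⟨d, hd, _⟩ => ⟨d, hd⟩

/-- `U(𝔭)` is stable under ALL Hasse–Schmidt derivations `D^{(β)}` (`𝔭` prime) — Dietel's criterion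
(3.4.3) (iii) for `H = U_x`. [cite: Dietel2015, Lemma (9.1.4) p. 108 and Prop. (3.4.3) (ii)⇒(iii) p. 43] -/
theorem isDiffStable_multAlgebra [DecidableEq σ] (𝔭 : Ideal (MvPolynomial σ k)) [𝔭.IsPrime] :
    IsDiffStable (multAlgebra k 𝔭) :=
  IsDiffStable.adjoin fun _ hs β => Algebra.subset_adjoin (hasseDeriv_mem_multGens hs β)

end Stable

/-! ## 3. The discharge -/

section Discharge

/-- **F-52 DISCHARGED — Hironaka 1970, Th. 1 Cor.: `U(𝔭)` is generated by purely inseparable (additive) forms.**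
For every field `k` of characteristic `p > 0`, every `n` and every point `𝔭` of `ℙⁿ_k` (`IsPoint`; only the primality
of `𝔭` is used), `U(𝔭) = k[{g ∈ U(𝔭) | g = Σ_j a_j X_j^{p^e}}]`. Proof: `U(𝔭)` is graded and Hasse–Schmidt stable
(§2), so by the structure theorem over an arbitrary field (`exists_eq_adjoin_triangular_of_isDiffStable_fin`,
Hironaka–Giraud triangular additive basis) `U(𝔭) = k[σ_1, …, σ_r]` with `σ_j = addForm k p e_j c_j ∈ U(𝔭)`.
[cite: Hironaka1970AdditiveGroups, Th. 1 Cor.] [cite: Mizutani1973HironakaGroupSchemes, p. 85 L26–28]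
[cite: Dietel2015, Lemma (9.1.4) p. 108 (printed proof) with Prop. (3.4.3) p. 43] -/
theorem Hironaka1970_thm1_cor_holds : ∀ (p : ℕ) [Fact p.Prime], Hironaka1970_thm1_cor.{u} p := by
  intro p _ k _ _ n 𝔭 hP
  obtain ⟨hprime, -, -⟩ := hP
  haveI : ExpChar k p := ExpChar.prime (Fact.out : p.Prime)
  obtain ⟨r, ι, e, c, -, -, -, -, -, -, hU⟩ :=
    exists_eq_adjoin_triangular_of_isDiffStable_fin p (multAlgebra k 𝔭)
      (isGradedSubalgebra_multAlgebra 𝔭) (isDiffStable_multAlgebra 𝔭)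
  apply le_antisymm
  · rw [hU]
    refine Algebra.adjoin_le ?_
    rintro _ ⟨j, rfl⟩
    exact Algebra.subset_adjoin ⟨Algebra.subset_adjoin ⟨j, rfl⟩, e j, c j, rfl⟩
  · exact Algebra.adjoin_le fun g hg => hg.1

end Discharge

end Literature.AlgebraicGeometry.Resolution.HironakaScheme

end
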